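import Summits.CriticalPhenomena.PercolationContinuityZ3.Theorems.Transplant.FKConnectivityAllQWheelRimSpokeNegCorr
import HarnessLib

/-!
# Connectivity correlation inequalities for `φ_{w,q}`, every `q > 0` — THEOREM W″, the remaining incident pair: the rim edge `v_y v_{y+1}`
# and the spoke AT `v_y` of an apex-over-cycle weighted graph are negatively correlated under `φ_{w,q}`, `0 < q ≤ 1`

Support file (`--supports stmt-CriticalPhenomena-4575`), FK sub-lane `prim-bschramm-fk-3` (gen 8) of the post-continuity programme; builds on
p205010 (kernel theorem, internal audit signed; external expert review pending).  No definitions, no named facts, no sorries; standard axioms.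
Paper proof: bschramm/prim-bschramm-fk-3/WHEELS-HUB-NC.md §10.

`…AllQWheelRimSpokeNegCorr.lean` treats the rim pair `s(v y, v (y+1))` against the spokes `s(x, v (y+d))`, `1 ≤ d ≤ n−1`; here `d = 0`: both pinned
slots sit in the same letter `E(a')·S(b')` of the transfer word, so the word read from `y` is `seg (y+1) (n−1)·E(a')·S(b')` and the two-slot
functional is `T(X,Y) = Tr(X·1·Y·B) − (2−q)ρ_B·X₀₀Y₁₁` with the EMPTY first stretch (`WordInv.one`) — the same trace form
`wheelRimSpoke_trace_form` applies.  **`FK.Wheel.wheel_negCorr_rim_spoke_same`**; with `wheel_negCorr_rim_spoke`, THEOREM W and THEOREM W′ every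
pair of wheel pairs is now covered by the transfer-matrix method.
[cite: Grimmett2006, §1.4 eq. (1.20) (p. 15); §3.9 eq. (3.94), Conj. (3.96) (pp. 63–66)] [cite: Wagner2006, Thm. 5.8, §5.3 (pp. 14–15)]
-/

noncomputable section

namespace Summit.CriticalPhenomena.PercolationContinuityZ3.Theorems

namespace FK

namespace Wheel

open Matrix WheelTM Literature.Probability.LatticeModels Literature.Probability.Percolation
open Literature.Probability.Percolation.DecisionTree (ind ind_of_mem ind_of_not_mem ind_nonneg)
open scoped Classical

variable {V : Type*} [Fintype V]

section Main

variable {x : V} {v : ℕ → V} {n : ℕ}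
variable (hn : 3 ≤ n) (hinj : ∀ j k, j < n → k < n → v j = v k → j = k) (hx : ∀ j, j < n → v j ≠ x) (hcard : Fintype.card V = n + 1)
include hn hinj hx hcard

omit [Fintype V] hcard in
/-- **The partition function through the two-slot functional, same-letter version**: for `w` with the rim pair AND the spoke of `v y` re-pinned to
`a', b'`, `Z = q·(Tr(E(a')·1·S(b')·B) − (2−q)·(1·ρ_B)·(a'(1−b')))` with `B = seg (y+1) (n−1)` and `ρ_B` its weight product. [folklore] -/
theorem transferT_two_slot_same (q : ℝ) (w : Sym2 V → unitInterval) {y : ℕ} (hy : y < n) (a' b' : unitInterval) :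
    transferT q (Function.update (Function.update w (rimPair v n y) a') (spokePair x v n y) b') x v n =
      q * ((edgeM q (a' : ℝ) * (1 : Matrix (Fin 2) (Fin 2) ℝ) * spokeM (b' : ℝ) * seg q (pOf w x v n) (rOf w v n) n (y + 1) (n - 1)).trace -
        (2 - q) * (1 * ∏ i ∈ Finset.range (n - 1), (rOf w v n ((y + 1 + i) % n) * (1 - pOf w x v n ((y + 1 + i) % n)))) *
          ((a' : ℝ) * (1 - (b' : ℝ)))) := by
  have hn1 : 1 ≤ n := by omega
  have hymod : y % n = y := Nat.mod_eq_of_lt hy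
  have hL₁ := letter_update_rim hn hinj hx q w hy a'
  have hr₁ : ∀ j, rOf (Function.update w (rimPair v n y) a') v n j = if j % n = y then (a' : ℝ) else rOf w v n j :=
    fun j => rOf_update_rim hn hinj w hy a' j
  have hp₁ : ∀ j, pOf (Function.update w (rimPair v n y) a') x v n j = pOf w x v n j := fun j => pOf_update_rim hn hx w y a' j
  have hL : ∀ j, letter q (pOf (Function.update (Function.update w (rimPair v n y) a') (spokePair x v n y) b') x v n)
      (rOf (Function.update (Function.update w (rimPair v n y) a') (spokePair x v n y) b') v n) n j =
      if j % n = y then edgeM q (rOf (Function.update w (rimPair v n y) a') v n y) * spokeM (b' : ℝ)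
      else letter q (pOf (Function.update w (rimPair v n y) a') x v n) (rOf (Function.update w (rimPair v n y) a') v n) n j :=
    fun j => letter_update_spoke hn hinj hx q _ hy b' j
  have hLw : ∀ j, j % n ≠ y →
      letter q (pOf (Function.update (Function.update w (rimPair v n y) a') (spokePair x v n y) b') x v n)
        (rOf (Function.update (Function.update w (rimPair v n y) a') (spokePair x v n y) b') v n) n j =
      letter q (pOf w x v n) (rOf w v n) n j := by
    intro j h1
    rw [hL j, if_neg h1, hL₁ j, if_neg h1]
  have hLy : letter q (pOf (Function.update (Function.update w (rimPair v n y) a') (spokePair x v n y) b') x v n)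
      (rOf (Function.update (Function.update w (rimPair v n y) a') (spokePair x v n y) b') v n) n y =
      edgeM q (a' : ℝ) * spokeM (b' : ℝ) := by
    rw [hL y, if_pos hymod, hr₁, hymod, if_pos rfl]
  obtain ⟨u, hu⟩ : ∃ u, u = Function.update (Function.update w (rimPair v n y) a') (spokePair x v n y) b' := ⟨_, rfl⟩
  rw [← hu] at hL hLw hLy ⊢
  -- the word read from `y`
  have hword : seg q (pOf u x v n) (rOf u v n) n y n =
      seg q (pOf w x v n) (rOf w v n) n (y + 1) (n - 1) * (edgeM q (a' : ℝ) * spokeM (b' : ℝ)) := by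
    have e1 : seg q (pOf u x v n) (rOf u v n) n y n = seg q (pOf u x v n) (rOf u v n) n (y + 1) (n - 1) * letter q (pOf u x v n) (rOf u v n) n y := by
      have := seg_add q (pOf u x v n) (rOf u v n) n y 1 (n - 1)
      rw [show 1 + (n - 1) = n by omega] at this
      rw [this]
      simp only [seg_succ, seg_zero, Matrix.mul_one, Nat.add_zero]
    have eB : seg q (pOf u x v n) (rOf u v n) n (y + 1) (n - 1) = seg q (pOf w x v n) (rOf w v n) n (y + 1) (n - 1) := by
      refine seg_congr n q _ _ fun j hj hj' => hLw j ?_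
      obtain ⟨t, rfl⟩ : ∃ t, j = y + t := ⟨j - y, by omega⟩
      exact fun h => mod_add_ne_mod (i := y) (t := t) (n := n) (by omega) (by omega) (h.trans hymod.symm)
    rw [e1, eB, hLy]
  have htr : (seg q (pOf u x v n) (rOf u v n) n y n).trace =
      (edgeM q (a' : ℝ) * (1 : Matrix (Fin 2) (Fin 2) ℝ) * spokeM (b' : ℝ) * seg q (pOf w x v n) (rOf w v n) n (y + 1) (n - 1)).trace := by
    conv_lhs => rw [hword, Matrix.trace_mul_comm]
    simp only [Matrix.mul_assoc, Matrix.one_mul]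
  -- the correction product
  have hru : ∀ j, rOf u v n j = if j % n = y then (a' : ℝ) else rOf w v n j := fun j => by
    rw [hu, rOf_update_spoke hn hx _ y b' j, hr₁]
  have hpu : ∀ j, pOf u x v n j = if j % n = y then (b' : ℝ) else pOf w x v n j := by
    intro j
    rw [hu, pOf_update_spoke hn hinj _ hy b' j]
    by_cases h : j % n = y
    · rw [if_pos h, if_pos h]
    · rw [if_neg h, if_neg h, hp₁]
  have hprod : (∏ j ∈ Finset.range n, rOf u v n j) * ∏ j ∈ Finset.range n, (1 - pOf u x v n j) =
      (1 * ∏ i ∈ Finset.range (n - 1), (rOf w v n ((y + 1 + i) % n) * (1 - pOf w x v n ((y + 1 + i) % n)))) *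
        ((a' : ℝ) * (1 - (b' : ℝ))) := by
    have hfull : (∏ j ∈ Finset.range n, rOf u v n j) * ∏ j ∈ Finset.range n, (1 - pOf u x v n j) =
        ∏ i ∈ Finset.range n, (fun m => rOf u v n m * (1 - pOf u x v n m)) ((y + i) % n) := by
      rw [← Finset.prod_mul_distrib]
      symm
      refine Finset.prod_nbij (fun i => (y + i) % n) (fun i _ => Finset.mem_range.2 (Nat.mod_lt _ (by omega))) ?_ ?_ (fun i _ => rfl)
      · intro i hi j hj h
        have hi' := Finset.mem_range.1 (Finset.mem_coe.1 hi)
        have hj' := Finset.mem_range.1 (Finset.mem_coe.1 hj)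
        have h2 := Nat.ModEq.add_left_cancel' y (show (y + i) % n = (y + j) % n from h)
        rw [Nat.ModEq, Nat.mod_eq_of_lt hi', Nat.mod_eq_of_lt hj'] at h2
        exact h2
      · intro m hm
        have hm' := Finset.mem_range.1 (Finset.mem_coe.1 hm)
        refine ⟨(m + n - y) % n, Finset.mem_coe.2 (Finset.mem_range.2 (Nat.mod_lt _ (by omega))), ?_⟩
        show (y + (m + n - y) % n) % n = m
        rw [Nat.add_mod, Nat.mod_mod, ← Nat.add_mod, show y + (m + n - y) = m + n by omega, Nat.add_mod_right,
          Nat.mod_eq_of_lt hm']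
    rw [hfull, show Finset.range n = Finset.range (n - 1 + 1) by congr 1; omega, Finset.prod_range_succ']
    have fy : rOf u v n ((y + 0) % n) * (1 - pOf u x v n ((y + 0) % n)) = (a' : ℝ) * (1 - (b' : ℝ)) := by
      rw [Nat.add_zero, hymod, hru, hpu, hymod, if_pos rfl, if_pos rfl]
    have fB : ∀ i ∈ Finset.range (n - 1), rOf u v n ((y + (i + 1)) % n) * (1 - pOf u x v n ((y + (i + 1)) % n)) =
        rOf w v n ((y + 1 + i) % n) * (1 - pOf w x v n ((y + 1 + i) % n)) := by
      intro i hi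
      have hi' := Finset.mem_range.1 hi
      have hne : (y + 1 + i) % n ≠ y := by
        rw [show y + 1 + i = y + (1 + i) by omega]
        exact fun h => mod_add_ne_mod (i := y) (t := 1 + i) (n := n) (by omega) (by omega) (h.trans hymod.symm)
      rw [show y + (i + 1) = y + 1 + i by omega, hru, hpu, Nat.mod_mod, if_neg hne, if_neg hne]
    simp only []
    rw [fy, Finset.prod_congr rfl fB]
    ring
  unfold transferT
  rw [← trace_seg_rotate q _ _ n y hy.le, htr, mul_assoc (2 - q) (∏ j ∈ Finset.range n, rOf u v n j), hprod]
  ring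

/-- **THEOREM W″, incident spoke at `v y`**: for `0 < q ≤ 1` and every weight vector supported on the wheel pairs, the rim pair `s(v y, v (y+1))` and the
spoke `s(x, v y)` are negatively correlated under `φ_{w,q}`. (transcription of bschramm/prim-bschramm-fk-3/WHEELS-HUB-NC.md §10) -/
theorem wheel_negCorr_rim_spoke_same {q : ℝ} (hq0 : 0 < q) (hq1 : q ≤ 1) (w : Sym2 V → unitInterval)
    (hsupp : ∀ e, e ∉ wheelPairs x v n → w e = 0) {y : ℕ} (hy : y < n) :
    (rcMeasureW w q ∅).real ({ω : BondConfig V | rimPair v n y ∈ ω} ∩ {ω | spokePair x v n y ∈ ω}) ≤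
      (rcMeasureW w q ∅).real {ω : BondConfig V | rimPair v n y ∈ ω} *
        (rcMeasureW w q ∅).real {ω : BondConfig V | spokePair x v n y ∈ ω} := by
  have hfe : spokePair x v n y ≠ rimPair v n y := spokePair_ne_rimPair hn hx _ _
  have hsupp1 : ∀ (a' b' : unitInterval), ∀ g, g ∉ wheelPairs x v n →
      Function.update (Function.update w (rimPair v n y) a') (spokePair x v n y) b' g = 0 :=
    fun a' b' => supp_update_spoke _ (supp_update_rim w hsupp hy a') hy b'
  have hZ : ∀ (a' b' : unitInterval),
      rcPartitionFunctionW (Function.update (Function.update w (rimPair v n y) a') (spokePair x v n y) b') q ∅ =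
        transferT q (Function.update (Function.update w (rimPair v n y) a') (spokePair x v n y) b') x v n :=
    fun a' b' => rcPartitionFunctionW_eq_transferT hn hinj hx hcard q _ (hsupp1 a' b')
  have hT := fun (a' b' : unitInterval) => transferT_two_slot_same hn hinj hx q w hy a' b'
  have hp01 : ∀ j, 0 ≤ pOf w x v n j ∧ pOf w x v n j ≤ 1 := fun j => ⟨(w _).2.1, (w _).2.2⟩
  have hr01 : ∀ j, 0 ≤ rOf w v n j ∧ rOf w v n j ≤ 1 := fun j => ⟨(w _).2.1, (w _).2.2⟩
  have hIB : WordInv q (∏ i ∈ Finset.range (n - 1), (rOf w v n ((y + 1 + i) % n) * (1 - pOf w x v n ((y + 1 + i) % n))))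
      (seg q (pOf w x v n) (rOf w v n) n (y + 1) (n - 1)) := by
    have h1 := wordInv_seg_mul hq0 hq1 hp01 hr01 n (y + 1) (WordInv.one q) (n - 1)
    rwa [Matrix.mul_one, mul_one] at h1
  have hTF := wheelRimSpoke_trace_form hq0.le hq1 (WordInv.one q) hIB
  generalize hA : (1 : Matrix (Fin 2) (Fin 2) ℝ) = A at hT hTF
  generalize hB : seg q (pOf w x v n) (rOf w v n) n (y + 1) (n - 1) = B at hT hTF
  generalize hρB : (∏ i ∈ Finset.range (n - 1), (rOf w v n ((y + 1 + i) % n) * (1 - pOf w x v n ((y + 1 + i) % n)))) = ρB at hT hTF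
  have ha0 : 0 ≤ ((w (rimPair v n y) : unitInterval) : ℝ) := (w _).2.1
  have ha1 : ((w (rimPair v n y) : unitInterval) : ℝ) ≤ 1 := (w _).2.2
  have hb0 : 0 ≤ ((w (spokePair x v n y) : unitInterval) : ℝ) := (w _).2.1
  have hb1 : ((w (spokePair x v n y) : unitInterval) : ℝ) ≤ 1 := (w _).2.2
  have hZw : rcPartitionFunctionW w q ∅ =
      rcPartitionFunctionW (Function.update (Function.update w (rimPair v n y) (w (rimPair v n y))) (spokePair x v n y)
        (w (spokePair x v n y))) q ∅ := by
    rw [Function.update_eq_self, Function.update_eq_self]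
  have hSe : ∑ ω : BondConfig V, rcWeightW w q ∅ ω * ind {ω : BondConfig V | rimPair v n y ∈ ω} ω =
      ((w (rimPair v n y) : unitInterval) : ℝ) *
        rcPartitionFunctionW (Function.update (Function.update w (rimPair v n y) 1) (spokePair x v n y) (w (spokePair x v n y))) q ∅ := by
    rw [sum_openPair_eq_mul_Z w q (rimPair v n y)]
    congr 2
    conv_lhs => rw [← Function.update_eq_self (spokePair x v n y) (Function.update w (rimPair v n y) 1)]
    rw [Function.update_of_ne hfe]
  have hSf : ∑ ω : BondConfig V, rcWeightW w q ∅ ω * ind {ω : BondConfig V | spokePair x v n y ∈ ω} ω =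
      ((w (spokePair x v n y) : unitInterval) : ℝ) *
        rcPartitionFunctionW (Function.update (Function.update w (rimPair v n y) (w (rimPair v n y))) (spokePair x v n y) 1) q ∅ := by
    rw [sum_openPair_eq_mul_Z w q (spokePair x v n y), Function.update_eq_self]
  have hSef : ∑ ω : BondConfig V, rcWeightW w q ∅ ω * ind ({ω : BondConfig V | rimPair v n y ∈ ω} ∩ {ω | spokePair x v n y ∈ ω}) ω =
      ((w (rimPair v n y) : unitInterval) : ℝ) * ((w (spokePair x v n y) : unitInterval) : ℝ) *
        rcPartitionFunctionW (Function.update (Function.update w (rimPair v n y) 1) (spokePair x v n y) 1) q ∅ :=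
    sum_openPair_inter_openPair_eq w q hfe
  have tES : ∀ a c : ℝ, (edgeM q a * A * spokeM c * B).trace =
      a * (1 - c) * (A * B).trace + (1 - a) * (1 - c) * ((A * B) 0 1 + q * (A * B) 1 1) + a * c * ((B * A) 0 0 + (B * A) 1 0) +
        (1 - a) * c * ((B 0 1 + B 1 1) * (A 0 0 + q * A 1 0)) := by
    intro a c
    simp only [Matrix.trace_fin_two, Matrix.mul_apply, Fin.sum_univ_two, spokeM_00, spokeM_01, spokeM_10, spokeM_11,
      edgeM_00, edgeM_01, edgeM_10, edgeM_11]
    ring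
  have hnn : 0 ≤ q ^ 2 * (((w (rimPair v n y) : unitInterval) : ℝ) * ((w (spokePair x v n y) : unitInterval) : ℝ)) *
      ((1 - ((w (rimPair v n y) : unitInterval) : ℝ)) * (1 - ((w (spokePair x v n y) : unitInterval) : ℝ))) *
      (((B 0 1 + B 1 1) * (A 0 0 + q * A 1 0)) * ((A * B).trace - (2 - q) * (1 * ρB)) -
        ((A * B) 0 1 + q * (A * B) 1 1) * ((B * A) 0 0 + (B * A) 1 0)) := by
    apply mul_nonneg
    · exact mul_nonneg (mul_nonneg (sq_nonneg q) (mul_nonneg ha0 hb0)) (mul_nonneg (sub_nonneg.2 ha1) (sub_nonneg.2 hb1))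
    · linarith [hTF]
  have key : ∀ (a c tAB tKI tIP tKP ρ : ℝ),
      (a * (q * (1 * (1 - c) * tAB + (1 - 1) * (1 - c) * tKI + 1 * c * tIP + (1 - 1) * c * tKP - (2 - q) * ρ * (1 * (1 - c))))) *
          (c * (q * (a * (1 - 1) * tAB + (1 - a) * (1 - 1) * tKI + a * 1 * tIP + (1 - a) * 1 * tKP - (2 - q) * ρ * (a * (1 - 1))))) -
        (a * c * (q * (1 * (1 - 1) * tAB + (1 - 1) * (1 - 1) * tKI + 1 * 1 * tIP + (1 - 1) * 1 * tKP - (2 - q) * ρ * (1 * (1 - 1))))) *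
          (q * (a * (1 - c) * tAB + (1 - a) * (1 - c) * tKI + a * c * tIP + (1 - a) * c * tKP - (2 - q) * ρ * (a * (1 - c)))) =
      q ^ 2 * (a * c) * ((1 - a) * (1 - c)) * (tKP * (tAB - (2 - q) * ρ) - tKI * tIP) := by
    intro a c tAB tKI tIP tKP ρ; ring
  have main : (∑ ω : BondConfig V, rcWeightW w q ∅ ω * ind ({ω : BondConfig V | rimPair v n y ∈ ω} ∩ {ω | spokePair x v n y ∈ ω}) ω) *
      rcPartitionFunctionW w q ∅ ≤
      (∑ ω : BondConfig V, rcWeightW w q ∅ ω * ind {ω : BondConfig V | rimPair v n y ∈ ω} ω) *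
        ∑ ω : BondConfig V, rcWeightW w q ∅ ω * ind {ω : BondConfig V | spokePair x v n y ∈ ω} ω := by
    rw [hSef, hSe, hSf, hZw, hZ, hZ, hZ, hZ, hT, hT, hT, hT, Set.Icc.coe_one, tES, tES, tES, tES]
    have k := key ((w (rimPair v n y) : unitInterval) : ℝ) ((w (spokePair x v n y) : unitInterval) : ℝ) (A * B).trace
      ((A * B) 0 1 + q * (A * B) 1 1) ((B * A) 0 0 + (B * A) 1 0) ((B 0 1 + B 1 1) * (A 0 0 + q * A 1 0)) (1 * ρB)
    nlinarith [k, hnn]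
  have hZpos := rcPartitionFunctionW_pos w hq0 (∅ : Set V)
  rw [rcMeasureW_real_eq_sum_div w hq0, rcMeasureW_real_eq_sum_div w hq0, rcMeasureW_real_eq_sum_div w hq0, div_mul_div_comm,
    div_le_div_iff₀ hZpos (mul_pos hZpos hZpos)]
  nlinarith [mul_le_mul_of_nonneg_right main hZpos.le]

end Main

end Wheel

end FK

end Summit.CriticalPhenomena.PercolationContinuityZ3.Theorems
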